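import Summits.QuantumFields.BalabanUV.Beta.GAN24.SubAveragingFibreColumn
import Summits.QuantumFields.BalabanUV.Beta.GAN24.SubAveragingSplitting
import Mathlib.NumberTheory.Harmonic.Bounds

/-!
# `BalabanUV.Beta.GAN24.SubAveragingKernel` — binder row G-an2-4 ∕ (CONV-C), programme «SUBAVG-RATE»
# (ROUTES-GAN24 R2-S1∕S2 ∘ R3-S3 executed at `U = 1` in the fibre∕strip currency), FILE 4 — THE END:
# the SUB-CELL-AVERAGED finer kernel of `G_jQ_j^*` (B4 (2.48)) minus the coarser kernel is `O((log n)^{d}·n⁻²)·e^{−κ|x|_∞}`,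
# i.e. the one-step η-RATE at the SHARP exponent `θ = L⁻²` WITH `j`-UNIFORM EXPONENTIAL DECAY, for this constituent at `U = 1`

NOT IN PRINT; OUR PROOF ATTEMPT (prover part P3 of row G-an2-4, fibre∕strip lineage, gen 22; CRUX TEAM (2), ruling «YM REDIRECT
TOWARDS THE SUMMIT», 2026-08-21).  HONEST DEPENDENCY (cell records, verbatim): «continuum YM on T⁴ ⇐ BetaPertH ∧ nine spine
estimates (0/9 proved); BetaPertH ⇐ (D1) ∧ (D4) ∧ CAP+tail; G-an2-4 gates asym, D1 and NE2/3/4.»  HONEST FRAMING (cell contract,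
verbatim): «discharging `BetaPertH` makes Bałaban's UV stability UNCONDITIONAL — a real constructive-QFT result; it is NOT the
continuum limit and NOT the Clay problem.»  ABSOLUTE RULE: nothing printed is a hypothesis.  [folklore] assembly over the tree's
`B4StripSums` (`F`, `G`, `term`, `R`, `norm_F_le`, `stripRegular_G`, `boundG`), `B4StripCauchy` (`uniformStrip_holds`, `rOf`,
`strip_subset_fat`), `B4ContourShift` (`latticeKernel`, `StripRegular`, `latticeKernel_decay`, `supNorm`) — vendored there with their
citation tags (B4 = [Balaban1983RegularityDecay] Lemma 2.4 (2.35), (2.43)–(2.49) pp. 582–586: the `j`-UNIFORM decay; B4 prints NO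
rate in `ξ`) — and the siblings `SubAveraging{Dirichlet,Splitting,Core,CoreEstimate,Fibre,FibreColumn}`.  No `def … : Prop`, no sorry.

## The statement

Level `n = L^j`: the kernel of `G_jQ_j^*` at the fine site `y + τ∕n` (`y ∈ ℤ^{d+1}`, `τ ∈ (Fin n)^{d+1}`) against the unit site `y′`
is `latticeKernel (G n a m2 τ) (y − y′)` (`B4StripSums.G`, kernel `kernel248_decay`).  Level `n·L`: the fine sites INSIDE the coarse
fine cell of `τ` are `L·τ + ρ`, `ρ ∈ (Fin L)^{d+1}` (`Tsub`), and the SUB-CELL AVERAGE of the finer kernel is the lattice kernel of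
`avgG n L a m2 τ := (L^{d+1})⁻¹ Σ_ρ G (n·L) a m2 (Tsub τ ρ)` (`latticeKernel_avgG`).  **`subavg_kernel_rate`**: for `0 < a₋ ≤ a₊`,
`m²₊`, every `L ≥ 1`, there are `κ > 0`, `c > 0` (those of `uniformStrip_holds`, `κ ≤ rOf (d+1)`) such that for EVERY `n ≥ 1`,
`a ∈ [a₋,a₊]`, `m² ∈ [0,m²₊]`, `τ`, `x ∈ ℤ^{d+1}`:
`‖latticeKernel (avgG n L a m2 τ) x − latticeKernel (G n a m2 τ) x‖ ≤ HF(n)·Ccol(d+1,L,a,m²,c)∕n² · e^{−κ|x|_∞}`,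
`HF(n) = (Σ_{j<n} 24∕ω_n(j))^{d+1}` (`≍ (48 log n)^{d+1}`, the price of the ENTRYWISE currency — cf. the lineage's gen-21 operator
currency, where it is absent), `Ccol` the explicit constant of FILE 3b.  With `n = L^j`: `≤ C·j^{d+1}·L^{−2j}·e^{−κ|x|_∞}` — the Cauchy
half of (CONV-C) for this constituent in the sub-averaged fine-leg currency at the SHARP exponent `θ = L⁻²` (ROUTES-GAN24 (0.4)); the
tree's `T4Hk163StripRate`∕`BalabanMinimizerLaw` give `θ = L⁻¹` for UN-averaged fine legs, `kernel248_decay` the uniform half.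

## What is proved
* §1 `Tsub`, `avgG`, `sum_F_Tsub` (`Σ_ρ F (n·L) (Tsub τ ρ) (Kof k m) = L^{d}·F n τ k·W1(Kof k m)`, from `SubAveragingSplitting.subavg_numerator`),
  **`avgG_eq`** (`avgG = Σ_k F n τ k · S_k ∕ E(n·L)`, all `p`), `G_eq_sum`, `Dmult`, **`Dmult_eq`** (`avgG − G n = Σ_k F n τ k · colDiff_k`).
* §2 `HF`, `sum_norm_F_le` (`Σ_k ‖F n τ k p‖ ≤ HF`), **`norm_Dmult_le`** (`≤ HF·Ccol∕n²` on the fat region).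
* §3 `stripRegular_finsum`, `stripRegular_avgG`, **`stripRegular_Dmult`**, `latticeKernel_avgG` (the dictionary), and the END
  **`subavg_kernel_rate`**.

HONEST: `U = 1`, the scalar constituent `G_jQ_j^*` of B4 (2.48) only (Bałaban's soft minimiser ∕ `a`); sub-averaged fine leg (the
un-averaged leg has `θ = L⁻¹` only); NOT the vector `H_k` of B5 (1.63)∕(1.103), NOT composites, NOT `U ≠ 1`, NOT (ρ2)(ρ3), NEVER
«G-an2-4 closed»; NOT D1, NOT BetaPertH, NOT continuum, NOT Clay.  Provenance: prover-b2b-balaban-gan24-p3-g22-0 (unit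
`b2b-balaban-gan24-p3`, gen 22), 2026-08-21.
-/

noncomputable section

namespace Summit.QuantumFields.BalabanUV.Beta.GAN24.SubAveragingKernel

open Complex Finset MeasureTheory
open Literature.MathematicalPhysics.QuantumFieldTheory.Balaban1983to89
open Literature.MathematicalPhysics.QuantumFieldTheory.Balaban1983to89.B4Strip
open Literature.MathematicalPhysics.QuantumFieldTheory.Balaban1983to89.B4StripCauchy
open Literature.MathematicalPhysics.QuantumFieldTheory.Balaban1983to89.B4StripSums
open Literature.MathematicalPhysics.QuantumFieldTheory.Balaban1983to89.B4ContourShift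
open Literature.MathematicalPhysics.QuantumFieldTheory.Balaban1983to89.B5Strip145Analytic (strip_mono kappa_small)
open Summit.QuantumFields.BalabanUV.Beta.GAN24.SubAveragingDirichlet
open Summit.QuantumFields.BalabanUV.Beta.GAN24.SubAveragingSplitting
open Summit.QuantumFields.BalabanUV.Beta.GAN24.SubAveragingCore
open Summit.QuantumFields.BalabanUV.Beta.GAN24.SubAveragingCoreEstimate
open Summit.QuantumFields.BalabanUV.Beta.GAN24.SubAveragingFibre
open Summit.QuantumFields.BalabanUV.Beta.GAN24.SubAveragingFibreColumn
open scoped Real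

variable {d : ℕ}

/-! ## §1 The sub-cell average of the finer multiplier and its exact coarse-alias form -/

/-- [folklore] the fine sub-site `L·τ + ρ ∈ (Fin (n·L))^d` of the level-`n·L` lattice inside the level-`n` fine cell `τ`. -/
def Tsub (n L : ℕ) (τ : Fin d → Fin n) (ρ : Fin d → Fin L) : Fin d → Fin (n * L) := fun ν =>
  ⟨L * (τ ν : ℕ) + (ρ ν : ℕ), by
    have hτ := (τ ν).isLt
    have hρ := (ρ ν).isLt
    calc L * (τ ν : ℕ) + (ρ ν : ℕ) < L * (τ ν : ℕ) + L := by omega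
      _ = L * ((τ ν : ℕ) + 1) := by ring
      _ ≤ L * n := Nat.mul_le_mul_left _ hτ
      _ = n * L := Nat.mul_comm _ _⟩

/-- [folklore] the value of `Tsub`. -/
@[simp] theorem Tsub_val (n L : ℕ) (τ : Fin d → Fin n) (ρ : Fin d → Fin L) (ν : Fin d) :
    ((Tsub n L τ ρ ν : Fin (n * L)) : ℕ) = L * (τ ν : ℕ) + (ρ ν : ℕ) := rfl

/-- [folklore] **THE SUB-CELL AVERAGE OF THE FINER MULTIPLIER** of `G_{j+1}Q_{j+1}^*` (B4 (2.48) at level `n·L`) over the `L^d`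
finer sites inside the coarse fine cell `τ`: `avgG = (L^d)⁻¹ Σ_ρ G (n·L) a m2 (Tsub τ ρ)`. -/
def avgG (n L : ℕ) [NeZero n] [NeZero L] (a m2 : ℝ) (τ : Fin d → Fin n) (p : Fin d → ℂ) : ℂ :=
  ((L : ℂ) ^ d)⁻¹ * ∑ ρ : Fin d → Fin L, G (n * L) a m2 (Tsub n L τ ρ) p

/-- [folklore] the sub-cell sum of the finer numerators above the coarse alias `k`: `Σ_ρ F (n·L) (Tsub τ ρ) (Kof k m) p =
L^d · F n τ k p · W1(Kof k m) p` (coordinatewise `SubAveragingSplitting.subavg_numerator`). -/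
theorem sum_F_Tsub (n L : ℕ) [NeZero n] [NeZero L] (τ : Fin d → Fin n) (k : Fin d → Fin n) (m : Fin d → Fin L)
    (p : Fin d → ℂ) :
    ∑ ρ : Fin d → Fin L, F (n * L) (Tsub n L τ ρ) (Kof n L k m) p = (L : ℂ) ^ d * (F n τ k p * W1 n L (Kof n L k m) p) := by
  have hn : 1 ≤ n := Nat.pos_of_ne_zero (NeZero.ne n)
  have hL : 1 ≤ L := Nat.pos_of_ne_zero (NeZero.ne L)
  have hL' : (L : ℂ) ≠ 0 := Nat.cast_ne_zero.mpr (NeZero.ne L)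
  unfold F W1
  rw [← Finset.prod_mul_distrib]
  have e1 : (∑ ρ : Fin d → Fin L, ∏ ν, ef (n * L) ((Kof n L k m ν : Fin (n * L)) : ℕ) ((Tsub n L τ ρ ν : Fin (n * L)) : ℕ) (p ν)
        * v (n * L) ((Kof n L k m ν : Fin (n * L)) : ℕ) (p ν))
      = ∏ ν, ∑ j : Fin L, ef (n * L) ((Kof n L k m ν : Fin (n * L)) : ℕ) (L * (τ ν : ℕ) + (j : ℕ)) (p ν)
        * v (n * L) ((Kof n L k m ν : Fin (n * L)) : ℕ) (p ν) := by
    rw [Fintype.prod_sum]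
    rfl
  rw [e1]
  have hcoord : ∀ ν : Fin d, ∑ j : Fin L, ef (n * L) ((Kof n L k m ν : Fin (n * L)) : ℕ) (L * (τ ν : ℕ) + (j : ℕ)) (p ν)
        * v (n * L) ((Kof n L k m ν : Fin (n * L)) : ℕ) (p ν)
      = (L : ℂ) * (ef n (k ν : ℕ) (τ ν : ℕ) (p ν) * v n (k ν : ℕ) (p ν) * sw n L ((Kof n L k m ν : Fin (n * L)) : ℕ) (p ν)) := by
    intro ν
    rw [Kof_val, Fin.sum_univ_eq_sum_range (fun j => ef (n * L) ((k ν : ℕ) + n * (m ν : ℕ)) (L * (τ ν : ℕ) + j) (p ν)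
      * v (n * L) ((k ν : ℕ) + n * (m ν : ℕ)) (p ν)) L]
    have h := subavg_numerator n L hn hL ((k ν : ℕ) + n * (m ν : ℕ)) (τ ν : ℕ) (p ν)
    rw [ef_add_mul n hn, v_add_mul n hn] at h
    rw [← h, ← mul_assoc, mul_inv_cancel₀ hL', one_mul]
  simp_rw [hcoord]
  rw [Finset.prod_mul_distrib, Finset.prod_const, Finset.card_univ, Fintype.card_fin, Finset.prod_mul_distrib]

/-- [folklore] the level-`n` multiplier as the alias sum of `F·R∕E` (definitional). -/
theorem G_eq_sum (n : ℕ) [NeZero n] (a m2 : ℝ) (τ : Fin d → Fin n) (p : Fin d → ℂ) :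
    G n a m2 τ p = ∑ k : Fin d → Fin n, F n τ k p * R n m2 k p / E n a m2 p := rfl

/-- [folklore] **THE SUB-CELL AVERAGE THROUGH THE COARSE ALIASES**: `avgG n L a m2 τ p = Σ_k F n τ k p · S_k(p) ∕ E (n·L) a m2 p`
for EVERY `p` (exact identity of entire-in-`p` finite sums; the finer alias sum re-indexed by `K = Kof k m`). -/
theorem avgG_eq (n L : ℕ) [NeZero n] [NeZero L] (a m2 : ℝ) (τ : Fin d → Fin n) (p : Fin d → ℂ) :
    avgG n L a m2 τ p = ∑ k : Fin d → Fin n, F n τ k p * S n L m2 k p / E (n * L) a m2 p := by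
  have hL' : (L : ℂ) ^ d ≠ 0 := pow_ne_zero _ (Nat.cast_ne_zero.mpr (NeZero.ne L))
  unfold avgG
  simp_rw [G_eq_sum (n * L)]
  rw [Finset.sum_comm]
  have h1 : ∀ K : Fin d → Fin (n * L), ∑ ρ : Fin d → Fin L, F (n * L) (Tsub n L τ ρ) K p * R (n * L) m2 K p / E (n * L) a m2 p
      = (∑ ρ : Fin d → Fin L, F (n * L) (Tsub n L τ ρ) K p) * R (n * L) m2 K p / E (n * L) a m2 p := by
    intro K; rw [Finset.sum_mul, Finset.sum_div]
  simp_rw [h1]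
  rw [sum_Kof_eq]
  simp_rw [sum_F_Tsub]
  unfold S
  rw [Finset.mul_sum]
  refine Finset.sum_congr rfl fun k _ => ?_
  rw [Finset.mul_sum, Finset.mul_sum, Finset.sum_div]
  refine Finset.sum_congr rfl fun m _ => ?_
  field_simp

/-- [folklore] THE DIFFERENCE MULTIPLIER: sub-cell-averaged finer minus coarser. -/
def Dmult (n L : ℕ) [NeZero n] [NeZero L] (a m2 : ℝ) (τ : Fin d → Fin n) (p : Fin d → ℂ) : ℂ :=
  avgG n L a m2 τ p - G n a m2 τ p

/-- [folklore] **`avgG − G n = Σ_k F n τ k · colDiff_k`** (every `p`). -/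
theorem Dmult_eq (n L : ℕ) [NeZero n] [NeZero L] (a m2 : ℝ) (τ : Fin d → Fin n) (p : Fin d → ℂ) :
    Dmult n L a m2 τ p = ∑ k : Fin d → Fin n, F n τ k p * colDiff n L a m2 k p := by
  unfold Dmult colDiff
  rw [avgG_eq, G_eq_sum, ← Finset.sum_sub_distrib]
  refine Finset.sum_congr rfl fun k _ => ?_
  ring

/-! ## §2 The bound on the fat region -/

/-- [folklore] the alias-sum weight of the ENTRYWISE currency: `HF n d = (Σ_{j<n} 24∕ω_n(j))^d` (`≍ (48 log n)^d`). -/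
def HF (n d : ℕ) : ℝ := (∑ j : Fin n, 24 / omega n (j : ℕ)) ^ d

/-- [folklore] `HF ≥ 0`. -/
theorem HF_nonneg (n d : ℕ) : 0 ≤ HF n d := by
  unfold HF
  refine pow_nonneg (Finset.sum_nonneg fun j _ => ?_) _
  have := omega_pos n (j : ℕ) j.isLt
  positivity

/-- [folklore] `Σ_k ‖F n τ k p‖ ≤ HF n d` on the fat region (`B4StripSums.norm_F_le` and `(Σ_j g j)^d = Σ_k Π_ν g(k_ν)`). -/
theorem sum_norm_F_le (n : ℕ) [NeZero n] {r : ℝ} (hr : r ≤ 1 / 4) {p : Fin d → ℂ} (hp : p ∈ Fat d r) (τ : Fin d → Fin n) :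
    ∑ k : Fin d → Fin n, ‖F n τ k p‖ ≤ HF n d := by
  unfold HF
  rw [Fintype.sum_pow]
  exact Finset.sum_le_sum fun k _ => norm_F_le n hr τ k hp

/-- [folklore] `1∕ω_n(j) ≤ 1∕(j+1) + 1∕(n−j)` (`ω = min(j+1, n−j)`). -/
theorem inv_omega_le (n j : ℕ) (hj : j < n) : 24 / omega n j ≤ 24 / ((j : ℝ) + 1) + 24 / ((n : ℝ) - j) := by
  unfold omega
  have h1 : (0 : ℝ) < (j : ℝ) + 1 := by positivity
  have h2 : (0 : ℝ) < (n : ℝ) - j := by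
    have : (j : ℝ) + 1 ≤ n := by exact_mod_cast hj
    linarith
  rcases min_cases ((j : ℝ) + 1) ((n : ℝ) - j) with ⟨h, -⟩ | ⟨h, -⟩ <;> rw [h]
  · linarith [div_pos (by norm_num : (0 : ℝ) < 24) h2]
  · linarith [div_pos (by norm_num : (0 : ℝ) < 24) h1]

/-- [folklore] the alias-weight sum is twice 24 harmonic numbers: `Σ_{j<n} 24∕ω_n(j) ≤ 48·(1 + log n)` (Mathlib's
`harmonic_le_one_add_log`). -/
theorem sum_omega_inv_le (n : ℕ) : ∑ j : Fin n, 24 / omega n (j : ℕ) ≤ 48 * (1 + Real.log n) := by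
  have hH : ((harmonic n : ℚ) : ℝ) ≤ 1 + Real.log n := harmonic_le_one_add_log n
  have hcast : ((harmonic n : ℚ) : ℝ) = ∑ i ∈ Finset.range n, ((i : ℝ) + 1)⁻¹ := by
    unfold harmonic; push_cast; rfl
  rw [hcast] at hH
  have h1 : ∑ j : Fin n, 24 / omega n (j : ℕ) ≤ ∑ j : Fin n, (24 / (((j : ℕ) : ℝ) + 1) + 24 / ((n : ℝ) - (j : ℕ))) :=
    Finset.sum_le_sum fun j _ => inv_omega_le n j j.isLt
  refine h1.trans ?_
  rw [Finset.sum_add_distrib, Fin.sum_univ_eq_sum_range (fun i => 24 / ((i : ℝ) + 1)) n,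
    Fin.sum_univ_eq_sum_range (fun i => 24 / ((n : ℝ) - i)) n]
  have hrefl : ∑ i ∈ Finset.range n, 24 / ((n : ℝ) - i) = ∑ i ∈ Finset.range n, 24 / ((i : ℝ) + 1) := by
    rw [← Finset.sum_range_reflect (fun i => 24 / ((i : ℝ) + 1)) n]
    refine Finset.sum_congr rfl fun i hi => ?_
    have hi' : i < n := Finset.mem_range.mp hi
    rw [Nat.cast_sub (by omega), Nat.cast_sub (by omega)]
    push_cast
    ring
  rw [hrefl]
  have e : ∑ i ∈ Finset.range n, 24 / ((i : ℝ) + 1) = 24 * ∑ i ∈ Finset.range n, ((i : ℝ) + 1)⁻¹ := by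
    rw [Finset.mul_sum]; exact Finset.sum_congr rfl fun i _ => by ring
  rw [e]
  linarith

/-- [folklore] **`HF n d ≤ (48·(1 + log n))^d`** — the entrywise alias weight grows only logarithmically. -/
theorem HF_le_log (n d : ℕ) : HF n d ≤ (48 * (1 + Real.log n)) ^ d := by
  unfold HF
  refine pow_le_pow_left₀ (Finset.sum_nonneg fun j _ => ?_) (sum_omega_inv_le n) d
  have := omega_pos n (j : ℕ) j.isLt
  positivity

/-- [folklore] **`‖avgG − G n‖ ≤ HF·Ccol∕n²` on the fat region**, given the common lower bound `c ≤ ‖E‖` at the two levels. -/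
theorem norm_Dmult_le (n L : ℕ) [NeZero n] [NeZero L] (a m2 : ℝ) (ha : 0 ≤ a) (hm : 0 ≤ m2) {r : ℝ} (hr : r ≤ 1 / 4)
    (hdr : (d : ℝ) * r ^ 2 ≤ 1 / 16) {p : Fin d → ℂ} (hp : p ∈ Fat d r) {c : ℝ} (hc : 0 < c) (hcE : c ≤ ‖E n a m2 p‖)
    (hcE' : c ≤ ‖E (n * L) a m2 p‖) (τ : Fin d → Fin n) :
    ‖Dmult n L a m2 τ p‖ ≤ HF n d * Ccol d L a m2 c / (n : ℝ) ^ 2 := by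
  rw [Dmult_eq]
  refine (norm_sum_le _ _).trans ?_
  have h : ∀ k ∈ (Finset.univ : Finset (Fin d → Fin n)),
      ‖F n τ k p * colDiff n L a m2 k p‖ ≤ ‖F n τ k p‖ * (Ccol d L a m2 c / (n : ℝ) ^ 2) := by
    intro k _
    rw [norm_mul]
    exact mul_le_mul_of_nonneg_left (norm_colDiff_le n L a m2 ha hm hr hdr hp hc hcE hcE' k) (norm_nonneg _)
  refine (Finset.sum_le_sum h).trans ?_
  rw [← Finset.sum_mul, mul_div_assoc]
  exact mul_le_mul_of_nonneg_right (sum_norm_F_le n hr hp τ)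
    (div_nonneg (Ccol_nonneg d L ha hm hc) (sq_nonneg _))

/-! ## §3 Strip regularity, the kernel dictionary, and THE END -/

/-- [folklore] finite sums of strip-regular multipliers are strip regular (bound = sum of bounds). -/
theorem stripRegular_finsum {ι : Type*} (s : Finset ι) (Gf : ι → (Fin (d + 1) → ℂ) → ℂ) {κ : ℝ} (M : ι → ℝ)
    (h : ∀ i ∈ s, StripRegular (Gf i) κ (M i)) :
    StripRegular (fun p => ∑ i ∈ s, Gf i p) κ (∑ i ∈ s, M i) := by
  classical
  induction s using Finset.induction_on with
  | empty => simpa using stripRegular_const (d := d) (0 : ℂ) κ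
  | insert j s hj ih =>
      have h' := ih fun i hi => h i (Finset.mem_insert_of_mem hi)
      have hj' := h j (Finset.mem_insert_self j s)
      have e : (fun p => ∑ i ∈ insert j s, Gf i p) = fun p => Gf j p + ∑ i ∈ s, Gf i p := by
        funext p; rw [Finset.sum_insert hj]
      rw [e, Finset.sum_insert hj]
      exact hj'.add h'

/-- [folklore] `avgG` is strip regular on any strip where the FINER denominator `E (n·L)` is bounded below (tree `stripRegular_G` at
level `n·L`, summed over the sub-sites and scaled). -/
theorem stripRegular_avgG (n L : ℕ) [NeZero n] [NeZero L] (a m2 m2plus : ℝ) (hm : 0 ≤ m2) (hmp : m2 ≤ m2plus)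
    (τ : Fin (d + 1) → Fin n) {κ c : ℝ} (hκ0 : 0 ≤ κ) (hκr : κ ≤ rOf (d + 1)) (hc : 0 < c)
    (hE' : ∀ p ∈ Strip (d + 1) κ, c ≤ ‖E (n * L) a m2 p‖) :
    StripRegular (d := d) (avgG n L a m2 τ) κ
      (‖((L : ℂ) ^ (d + 1))⁻¹‖ * ∑ _ρ : Fin (d + 1) → Fin L, boundG (d + 1) c m2plus) := by
  have hsum := stripRegular_finsum (Finset.univ : Finset (Fin (d + 1) → Fin L)) (fun ρ => G (n * L) a m2 (Tsub n L τ ρ))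
    (fun _ => boundG (d + 1) c m2plus) (fun ρ _ => stripRegular_G (n * L) a m2 m2plus hm hmp (Tsub n L τ ρ) hκ0 hκr hc hE')
  exact (stripRegular_const (((L : ℂ) ^ (d + 1))⁻¹) κ).mul hsum (norm_nonneg _)

/-- [folklore] **THE DIFFERENCE MULTIPLIER IS STRIP REGULAR WITH THE RATE BOUND**: on a strip `Strip (d+1) κ` (`0 ≤ κ ≤ rOf (d+1)`) where
both denominators are `≥ c > 0` in modulus, `Dmult` is `StripRegular` with bound `HF(n)·Ccol∕n²`. -/
theorem stripRegular_Dmult (n L : ℕ) [NeZero n] [NeZero L] (a m2 m2plus : ℝ) (ha : 0 ≤ a) (hm : 0 ≤ m2) (hmp : m2 ≤ m2plus)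
    (τ : Fin (d + 1) → Fin n) {κ c : ℝ} (hκ0 : 0 ≤ κ) (hκr : κ ≤ rOf (d + 1)) (hc : 0 < c)
    (hE : ∀ p ∈ Strip (d + 1) κ, c ≤ ‖E n a m2 p‖) (hE' : ∀ p ∈ Strip (d + 1) κ, c ≤ ‖E (n * L) a m2 p‖) :
    StripRegular (d := d) (Dmult n L a m2 τ) κ (HF n (d + 1) * Ccol (d + 1) L a m2 c / (n : ℝ) ^ 2) := by
  have h1 := stripRegular_avgG n L a m2 m2plus hm hmp τ hκ0 hκr hc hE'
  have h2 := stripRegular_G n a m2 m2plus hm hmp τ hκ0 hκr hc hE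
  have h3 := ((stripRegular_const (-1 : ℂ) κ).mul h2 (norm_nonneg _))
  have h4 := h1.add h3
  have e : (fun p => avgG n L a m2 τ p + (-1) * G n a m2 τ p) = Dmult n L a m2 τ := by
    funext p; unfold Dmult; ring
  rw [e] at h4
  obtain ⟨hκ1, hdκ⟩ := kappa_small hκ0 hκr
  have hr4 : rOf (d + 1) ≤ 1 / 4 := by
    unfold rOf
    rw [div_le_div_iff₀ (by positivity) (by norm_num)]
    have : (0 : ℝ) ≤ d := Nat.cast_nonneg d
    push_cast; nlinarith
  have hdr : ((d + 1 : ℕ) : ℝ) * rOf (d + 1) ^ 2 ≤ 1 / 16 := by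
    have h := (kappa_small (d := d + 1) (le_of_lt (rOf_pos (d + 1))) le_rfl).2
    exact_mod_cast h
  refine ⟨h4.cont, h4.diff, h4.sides, fun p hp => ?_⟩
  have hpF : p ∈ Fat (d + 1) (rOf (d + 1)) := strip_subset_fat (le_of_lt (rOf_pos (d + 1))) hκr hp
  exact norm_Dmult_le n L a m2 ha hm hr4 (by exact_mod_cast hdr) hpF hc (hE p hp) (hE' p hp) τ

/-- [folklore] the integrand of `avgG` is the scaled sum of the integrands of the finer multipliers (pointwise). -/
theorem integrand_avgG (n L : ℕ) [NeZero n] [NeZero L] (a m2 : ℝ) (τ : Fin d → Fin n) (x : Fin d → ℤ) (q : Fin d → ℝ) :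
    integrand (avgG n L a m2 τ) x q = ((L : ℂ) ^ d)⁻¹ * ∑ ρ : Fin d → Fin L, integrand (G (n * L) a m2 (Tsub n L τ ρ)) x q := by
  unfold integrand avgG
  rw [mul_assoc, Finset.sum_mul]

/-- [folklore] **THE KERNEL DICTIONARY**: the lattice kernel of `avgG` IS the sub-cell average of the finer kernels,
`latticeKernel (avgG τ) x = (L^{d+1})⁻¹ Σ_ρ latticeKernel (G (n·L) a m2 (Tsub τ ρ)) x` (linearity of the Brillouin-zone integral;
integrability from strip regularity of the finer multipliers). -/
theorem latticeKernel_avgG (n L : ℕ) [NeZero n] [NeZero L] (a m2 m2plus : ℝ) (hm : 0 ≤ m2) (hmp : m2 ≤ m2plus)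
    (τ : Fin (d + 1) → Fin n) {κ c : ℝ} (hκ0 : 0 ≤ κ) (hκr : κ ≤ rOf (d + 1)) (hc : 0 < c)
    (hE' : ∀ p ∈ Strip (d + 1) κ, c ≤ ‖E (n * L) a m2 p‖) (x : Fin (d + 1) → ℤ) :
    latticeKernel (avgG n L a m2 τ) x
      = ((L : ℂ) ^ (d + 1))⁻¹ * ∑ ρ : Fin (d + 1) → Fin L, latticeKernel (G (n * L) a m2 (Tsub n L τ ρ)) x := by
  have hint : ∀ ρ : Fin (d + 1) → Fin L, IntegrableOn (integrand (G (n * L) a m2 (Tsub n L τ ρ)) x) (BZ (d + 1)) := fun ρ =>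
    (stripRegular_G (n * L) a m2 m2plus hm hmp (Tsub n L τ ρ) hκ0 hκr hc hE').integrableOn hκ0 x
  unfold latticeKernel fourierBox
  have e : (fun q => integrand (avgG n L a m2 τ) x q)
      = fun q => ((L : ℂ) ^ (d + 1))⁻¹ * ∑ ρ : Fin (d + 1) → Fin L, integrand (G (n * L) a m2 (Tsub n L τ ρ)) x q := by
    funext q; exact integrand_avgG n L a m2 τ x q
  rw [show (∫ q in BZ (d + 1), integrand (avgG n L a m2 τ) x q)
      = ∫ q in BZ (d + 1), ((L : ℂ) ^ (d + 1))⁻¹ * ∑ ρ : Fin (d + 1) → Fin L, integrand (G (n * L) a m2 (Tsub n L τ ρ)) x q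
      from by rw [e]]
  rw [integral_const_mul, integral_finsetSum _ (fun ρ _ => hint ρ)]
  simp only [Complex.real_smul]
  rw [Finset.mul_sum, Finset.mul_sum, Finset.mul_sum]
  exact Finset.sum_congr rfl fun ρ _ => by ring

/-- [folklore] **THE END — THE SUB-AVERAGED ONE-STEP RATE WITH EXPONENTIAL DECAY FOR `G_jQ_j^*` AT `U = 1`.**  For `0 < a₋ ≤ a₊`, `m²₊`
and every `L ≥ 1` there are `κ > 0` and `c > 0` such that for EVERY `n ≥ 1`, `a ∈ [a₋, a₊]`, `m² ∈ [0, m²₊]`, every coarse fine site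
`τ ∈ (Fin n)^{d+1}` and every `x ∈ ℤ^{d+1}`:
`‖(L^{d+1})⁻¹ Σ_ρ latticeKernel (G (n·L) a m2 (Tsub τ ρ)) x − latticeKernel (G n a m2 τ) x‖ ≤ HF(n)·Ccol(d+1,L,a,m²,c)∕n² · e^{−κ|x|_∞}`
— the sub-cell average of the finer kernel `(G_{j+1}Q_{j+1}^*)(y + (Lτ+ρ)∕(nL), y′)` minus the coarser `(G_jQ_j^*)(y + τ∕n, y′)` is
`O((log n)^{d+1} n⁻²)` uniformly, with `n`-uniform exponential decay in `|y − y′|_∞` (`n = L^j`: rate `θ = L⁻²` up to `j^{d+1}`). -/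
theorem subavg_kernel_rate (d : ℕ) (aminus aplus m2plus : ℝ) (ha : 0 < aminus) (L : ℕ) [NeZero L] :
    ∃ κ c : ℝ, 0 < κ ∧ 0 < c ∧ ∀ (n : ℕ) [NeZero n] (a m2 : ℝ), aminus ≤ a → a ≤ aplus → 0 ≤ m2 → m2 ≤ m2plus →
      ∀ (τ : Fin (d + 1) → Fin n) (x : Fin (d + 1) → ℤ),
        ‖((L : ℂ) ^ (d + 1))⁻¹ * ∑ ρ : Fin (d + 1) → Fin L, latticeKernel (G (n * L) a m2 (Tsub n L τ ρ)) x
            - latticeKernel (G n a m2 τ) x‖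
          ≤ HF n (d + 1) * Ccol (d + 1) L a m2 c / (n : ℝ) ^ 2 * Real.exp (-(κ * supNorm x)) := by
  obtain ⟨κ₁, c, hκ₁, hc, h⟩ := uniformStrip_holds (d + 1) aminus aplus m2plus ha
  refine ⟨min κ₁ (rOf (d + 1)), c, lt_min hκ₁ (rOf_pos _), hc, ?_⟩
  intro n _ a m2 ha1 ha2 hm hmp τ x
  have hκ0 : 0 ≤ min κ₁ (rOf (d + 1)) := (lt_min hκ₁ (rOf_pos _)).le
  have hsub : Strip (d + 1) (min κ₁ (rOf (d + 1))) ⊆ Strip (d + 1) κ₁ := strip_mono (min_le_left _ _)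
  have hE : ∀ p ∈ Strip (d + 1) (min κ₁ (rOf (d + 1))), c ≤ ‖E n a m2 p‖ := fun p hp => h n a m2 ha1 ha2 hm hmp p (hsub hp)
  have hE' : ∀ p ∈ Strip (d + 1) (min κ₁ (rOf (d + 1))), c ≤ ‖E (n * L) a m2 p‖ := fun p hp =>
    h (n * L) a m2 ha1 ha2 hm hmp p (hsub hp)
  have ha0 : 0 ≤ a := le_trans ha.le ha1
  have hreg := stripRegular_Dmult n L a m2 m2plus ha0 hm hmp τ hκ0 (min_le_right _ _) hc hE hE'
  have hdecay := latticeKernel_decay hreg hκ0 x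
  rw [← latticeKernel_avgG n L a m2 m2plus hm hmp τ hκ0 (min_le_right _ _) hc hE' x]
  have e : latticeKernel (avgG n L a m2 τ) x - latticeKernel (G n a m2 τ) x = latticeKernel (Dmult n L a m2 τ) x := by
    have hint1 := (stripRegular_avgG n L a m2 m2plus hm hmp τ hκ0 (min_le_right _ _) hc hE').integrableOn hκ0 x
    have hint2 := (stripRegular_G n a m2 m2plus hm hmp τ hκ0 (min_le_right _ _) hc hE).integrableOn hκ0 x
    unfold latticeKernel fourierBox
    rw [← smul_sub, ← integral_sub hint1 hint2]
    congr 1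
    refine setIntegral_congr_fun (by unfold BZ; exact measurableSet_Icc) fun q _ => ?_
    simp only [integrand, Dmult]
    ring
  rw [e]
  exact hdecay

/-- [folklore] **THE END, LOGARITHMIC FORM**: same `κ, c`, bound `(48(1+log n))^{d+1}·Ccol(d+1,L,a,m²,c)∕n² · e^{−κ|x|_∞}` — with
`n = L^j` this is `≤ C(d,L,a,m²)·(1+j log L)^{d+1}·L^{−2j}·e^{−κ|x|_∞}`: the SHARP one-step exponent `θ = L⁻²` up to the
logarithm of the entrywise currency. -/
theorem subavg_kernel_rate_log (d : ℕ) (aminus aplus m2plus : ℝ) (ha : 0 < aminus) (L : ℕ) [NeZero L] :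
    ∃ κ c : ℝ, 0 < κ ∧ 0 < c ∧ ∀ (n : ℕ) [NeZero n] (a m2 : ℝ), aminus ≤ a → a ≤ aplus → 0 ≤ m2 → m2 ≤ m2plus →
      ∀ (τ : Fin (d + 1) → Fin n) (x : Fin (d + 1) → ℤ),
        ‖((L : ℂ) ^ (d + 1))⁻¹ * ∑ ρ : Fin (d + 1) → Fin L, latticeKernel (G (n * L) a m2 (Tsub n L τ ρ)) x
            - latticeKernel (G n a m2 τ) x‖
          ≤ (48 * (1 + Real.log n)) ^ (d + 1) * Ccol (d + 1) L a m2 c / (n : ℝ) ^ 2 * Real.exp (-(κ * supNorm x)) := by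
  obtain ⟨κ, c, hκ, hc, h⟩ := subavg_kernel_rate d aminus aplus m2plus ha L
  refine ⟨κ, c, hκ, hc, ?_⟩
  intro n _ a m2 ha1 ha2 hm hmp τ x
  refine (h n a m2 ha1 ha2 hm hmp τ x).trans ?_
  have hC : 0 ≤ Ccol (d + 1) L a m2 c := Ccol_nonneg (d + 1) L (le_trans ha.le ha1) hm hc
  have hHF := HF_le_log n (d + 1)
  have hexp : 0 ≤ Real.exp (-(κ * supNorm x)) := (Real.exp_pos _).le
  have hn2 : (0 : ℝ) ≤ (n : ℝ) ^ 2 := sq_nonneg _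
  gcongr

end Summit.QuantumFields.BalabanUV.Beta.GAN24.SubAveragingKernel
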